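import Summits.KontsevichZagierPeriods.KontsevichZagierPeriods.Theorems.SymplecticScissorsPlanarTransport
import Summits.KontsevichZagierPeriods.KontsevichZagierPeriods.Theorems.AbelContractionRealArcKernelStrength

/-!
# RealArcKernel (stmt-KontsevichZagierPeriods-12472) — equivalence audit (crux-strategist q1, 2026-08-17)

The exact trust base of `RealArcKernel ↔ KontsevichZagierPeriods`: (1) the two route copies of the shared item
stmt-4990 agree (`Iff.rfl`); (2) modulo the cite-only named fact `HuberWustholzCurvePeriods` (Huber–Wüstholz 2022,
Thm 13.3 (2)) the crux IS the summit, axioms propext / Classical.choice / Quot.sound; (3) unconditionally the summit is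
EXACTLY `PlanarAreas ∧ RealArcKernel` (both conjuncts consequences of the summit). Companion: EQUIVALENCE-AUDIT.md.
Scratch only — nothing here is a route item; namespace kept private to this audit.
-/

open Literature.NumberTheory.Transcendental

namespace Summit.KontsevichZagierPeriods.AbelContraction.RealArcKernelEquivalenceAudit

-- (1) the two route copies of the shared item stmt-4990 are the same proposition
example : Summit.KontsevichZagierPeriods.KontsevichZagierPeriods.Theses.SymplecticScissors.PlanarAreas ↔
    Summit.KontsevichZagierPeriods.KontsevichZagierPeriods.Theses.AbelContraction.PlanarAreas := Iff.rfl

-- (2) the composite: modulo the cite-only named fact HW 2022 Thm 13.3(2), the crux IS the summit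
theorem realArcKernel_iff_summit_of_HW (hHW : HuberWustholzCurvePeriods) :
    Summit.KontsevichZagierPeriods.KontsevichZagierPeriods.Theses.AbelContraction.RealArcKernel ↔ KontsevichZagierPeriods :=
  Summit.KontsevichZagierPeriods.AbelContraction.RealArcKernelStrength.realArcKernel_iff_kontsevichZagierPeriods
    (Summit.KontsevichZagierPeriods.SymplecticScissors.PlanarTransport.planarAreas_of_huberWustholzCurvePeriods hHW)

-- (3) without HW: the summit is EXACTLY PlanarAreas ∧ RealArcKernel (both conjuncts consequences of S)
theorem summit_iff_planarAreas_and_realArcKernel :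
    KontsevichZagierPeriods ↔
      (Summit.KontsevichZagierPeriods.KontsevichZagierPeriods.Theses.AbelContraction.PlanarAreas ∧
        Summit.KontsevichZagierPeriods.KontsevichZagierPeriods.Theses.AbelContraction.RealArcKernel) := by
  constructor
  · intro hS
    refine ⟨?_, Summit.KontsevichZagierPeriods.AbelContraction.RealArcKernelStrength.realArcKernel_of_kontsevichZagierPeriods hS⟩
    intro r r' h1 h1' hv
    exact hS r r' ⟨1, 1, fun _ _ => by simp, fun x hx => by simp [h1 x hx]⟩
      ⟨1, 1, fun _ _ => by simp, fun x hx => by simp [h1' x hx]⟩ hv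
  · rintro ⟨hP, hX⟩
    exact (Summit.KontsevichZagierPeriods.AbelContraction.RealArcKernelStrength.realArcKernel_iff_kontsevichZagierPeriods hP).mp hX

end Summit.KontsevichZagierPeriods.AbelContraction.RealArcKernelEquivalenceAudit

#print axioms Summit.KontsevichZagierPeriods.SymplecticScissors.PlanarTransport.planarAreas_of_huberWustholzCurvePeriods
#print axioms Summit.KontsevichZagierPeriods.AbelContraction.RealArcKernelStrength.realArcKernel_iff_kontsevichZagierPeriods
#print axioms Summit.KontsevichZagierPeriods.AbelContraction.AreasToArcs.areasToArcs_proof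
#print axioms Literature.NumberTheory.Transcendental.kzKernelConjecture_iff_isRational
#print axioms Summit.KontsevichZagierPeriods.AbelContraction.RealArcKernelEquivalenceAudit.realArcKernel_iff_summit_of_HW
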